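import Summits.CriticalPhenomena.PercolationContinuityZ3.Theorems.PercNearOneGluingAdditiveGluingKnLemma2General
import HarnessLib

/-!
# `NoHeavyLowerTail` (stmt-CriticalPhenomena-4575) — block superadditivity of Kozma–Nitzan's `φ` (Lemma 2 for two blocks)

Support file (prover `prim-lf-7`; `--supports stmt-CriticalPhenomena-4575`).  No definitions, no named facts, no sorries.

KN's `φ_B := μ(o ↔ B | B ↮ S∖B)` for blocks `B ⊆ S`.  `GiantKn.phi_superadd`: for disjoint blocks `B₁, B₂ ⊆ S`,
`φ_{B₁} + φ_{B₂} ≤ φ_{B₁ ∪ B₂}` — Kozma–Nitzan's Lemma 2 (stated there for singletons, `knK_lemma2` in the tree) for two arbitrary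
blocks, by the same route: with `M' = {B₁ ↮ B₂, B₁ ↮ R, B₂ ↮ R}` (`R = S∖(B₁∪B₂)`), `φ_{B_i} ≤ μ(o↔B_i | M')` (BHK Thm 1.4),
`μ(o↔B₁ | M') + μ(o↔B₂ | M') = μ(o↔B₁∪B₂ | M')` (disjoint on `M'`), `μ(o↔B₁∪B₂ | M') ≤ φ_{B₁∪B₂}` (BHK Thm 1.3).
This is the "partition move" of the KN-flow certificates for `XZ_T` (prim-lf-7 CANDIDATES batch 8; companion of `GiantKn.phi_mono`).
[cite: KozmaNitzan2024, Lemmas 1–2 (pp. 5–6); VandenbergHaggstromKahn2005, Thms. 1.3, 1.4]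
-/

noncomputable section

namespace Summit.CriticalPhenomena.PercolationContinuityZ3.Theorems

open MeasureTheory Set Literature.Probability.LatticeModels Literature.Probability.Percolation
open scoped Classical BigOperators

variable {n : ℕ}

namespace GiantKn

/-- One BHK-1.4 step (KN Lemma 1 (i) for blocks): for `B ⊆ S`, `E ⊆ S∖B`, `R' ⊆ S∖B`, with `D = {B ↮ S∖B}` and
`PC = {E ↔ R'}`:  `μ(D ∩ {o↔B}) · μ(D ∖ PC) ≤ μ(D) · μ((D ∖ PC) ∩ {o↔B})`. -/
theorem phi_stepA (w : Sym2 (Fin n) → unitInterval) (o : Fin n) (S B E R' : Finset (Fin n)) (hE : E ⊆ S \ B) :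
    (prodBernoulli w).real ({ω : BondConfig (Fin n) | ∀ s ∈ B, ∀ t ∈ S \ B, ¬ (openGraph ω).Reachable s t} ∩
          ⋃ s ∈ B, (openConn s o : Set (BondConfig (Fin n)))) *
        (prodBernoulli w).real ({ω : BondConfig (Fin n) | ∀ s ∈ B, ∀ t ∈ S \ B, ¬ (openGraph ω).Reachable s t} \
          {ω | ∃ k ∈ E, ∃ j ∈ R', k ≠ j ∧ (openGraph ω).Reachable k j}) ≤
      (prodBernoulli w).real {ω : BondConfig (Fin n) | ∀ s ∈ B, ∀ t ∈ S \ B, ¬ (openGraph ω).Reachable s t} *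
        (prodBernoulli w).real (({ω : BondConfig (Fin n) | ∀ s ∈ B, ∀ t ∈ S \ B, ¬ (openGraph ω).Reachable s t} \
          {ω | ∃ k ∈ E, ∃ j ∈ R', k ≠ j ∧ (openGraph ω).Reachable k j}) ∩ ⋃ s ∈ B, (openConn s o : Set (BondConfig (Fin n)))) := by
  set μ := prodBernoulli w with hμ
  set D : Set (BondConfig (Fin n)) := {ω | ∀ s ∈ B, ∀ t ∈ S \ B, ¬ (openGraph ω).Reachable s t} with hD
  set At : Set (BondConfig (Fin n)) := ⋃ s ∈ B, (openConn s o : Set (BondConfig (Fin n))) with hAt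
  set PC : Set (BondConfig (Fin n)) := {ω | ∃ k ∈ E, ∃ j ∈ R', k ≠ j ∧ (openGraph ω).Reachable k j} with hPC
  have key := stub_bhkSets.2 n w B (S \ B)
    ({C : Set (Sym2 (Fin n)) | ∃ s ∈ B, (openGraph C).Reachable s o}.indicator 1)
    ({C : Set (Sym2 (Fin n)) | ∃ k ∈ E, ∃ j ∈ R', k ≠ j ∧ (openGraph C).Reachable k j}.indicator 1)
    (knThm2_monotone_anyReach B o) (knK_monotone_pairConn E R') Finset.disjoint_sdiff
  simp only [knThm2_anyReach_apply, knK_pairConn_apply (S \ B) E R' hE] at key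
  have h := knThm2_setIntegral_indicator w D At PC
  have h' := knThm2_setIntegral_indicator w D PC PC
  rw [← hD] at key
  rw [h.1, h'.1, h.2] at key
  have s1 : μ.real (D \ PC) = μ.real D - μ.real (D ∩ PC) := by
    have := measureReal_inter_add_sdiff (μ := μ) (s := D) (MeasurableSet.of_discrete (s := PC)); linarith
  have s2 : μ.real ((D \ PC) ∩ At) = μ.real (D ∩ At) - μ.real (D ∩ (At ∩ PC)) := by
    have := measureReal_inter_add_sdiff (μ := μ) (s := D ∩ At) (MeasurableSet.of_discrete (s := PC))
    have e : (D ∩ At) \ PC = (D \ PC) ∩ At := by ext ω; simp only [mem_sdiff, mem_inter_iff]; tauto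
    have e' : D ∩ At ∩ PC = D ∩ (At ∩ PC) := by rw [inter_assoc]
    rw [e, e'] at this; linarith
  rw [s1, s2]; nlinarith [key]

/-- One BHK-1.3 step (KN Lemma 1 (ii) for blocks): for `B₁ ⊆ B`, any `E`, with `D = {B ↮ S∖B}` and `PC = {B₁ ↔ E}`:
`μ((D ∖ PC) ∩ {o↔B}) · μ(D) ≤ μ(D ∖ PC) · μ(D ∩ {o↔B})`. -/
theorem phi_stepC (w : Sym2 (Fin n) → unitInterval) (o : Fin n) (S B B₁ E : Finset (Fin n)) (hB₁ : B₁ ⊆ B) :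
    (prodBernoulli w).real (({ω : BondConfig (Fin n) | ∀ s ∈ B, ∀ t ∈ S \ B, ¬ (openGraph ω).Reachable s t} \
          {ω | ∃ k ∈ B₁, ∃ j ∈ E, k ≠ j ∧ (openGraph ω).Reachable k j}) ∩ ⋃ s ∈ B, (openConn s o : Set (BondConfig (Fin n)))) *
        (prodBernoulli w).real {ω : BondConfig (Fin n) | ∀ s ∈ B, ∀ t ∈ S \ B, ¬ (openGraph ω).Reachable s t} ≤
      (prodBernoulli w).real ({ω : BondConfig (Fin n) | ∀ s ∈ B, ∀ t ∈ S \ B, ¬ (openGraph ω).Reachable s t} \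
          {ω | ∃ k ∈ B₁, ∃ j ∈ E, k ≠ j ∧ (openGraph ω).Reachable k j}) *
        (prodBernoulli w).real ({ω : BondConfig (Fin n) | ∀ s ∈ B, ∀ t ∈ S \ B, ¬ (openGraph ω).Reachable s t} ∩
          ⋃ s ∈ B, (openConn s o : Set (BondConfig (Fin n)))) := by
  set μ := prodBernoulli w with hμ
  set D : Set (BondConfig (Fin n)) := {ω | ∀ s ∈ B, ∀ t ∈ S \ B, ¬ (openGraph ω).Reachable s t} with hD
  set At : Set (BondConfig (Fin n)) := ⋃ s ∈ B, (openConn s o : Set (BondConfig (Fin n))) with hAt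
  set PC : Set (BondConfig (Fin n)) := {ω | ∃ k ∈ B₁, ∃ j ∈ E, k ≠ j ∧ (openGraph ω).Reachable k j} with hPC
  have hX : ∀ s ∈ B, s ∉ (↑(S \ B) : Set (Fin n)) := fun s hs h => by
    rw [Finset.mem_coe, Finset.mem_sdiff] at h; exact h.2 hs
  have key := stub_bhkSets.1 n w B (↑(S \ B) : Set (Fin n))
    ({C : Set (Sym2 (Fin n)) | ∃ s ∈ B, (openGraph C).Reachable s o}.indicator 1)
    ({C : Set (Sym2 (Fin n)) | ∃ k ∈ B₁, ∃ j ∈ E, k ≠ j ∧ (openGraph C).Reachable k j}.indicator 1)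
    (knThm2_monotone_anyReach B o) (knK_monotone_pairConn B₁ E) hX
  simp only [knThm2_anyReach_apply, knK_pairConn_apply B B₁ E hB₁] at key
  have eD : {ω : BondConfig (Fin n) | ∀ s ∈ B, ∀ x ∈ (↑(S \ B) : Set (Fin n)), ¬ (openGraph ω).Reachable s x} = D := by
    ext ω; simp only [mem_setOf_eq, Finset.mem_coe, hD]
  rw [eD] at key
  have h := knThm2_setIntegral_indicator w D At PC
  have h' := knThm2_setIntegral_indicator w D PC PC
  rw [h.1, h'.1, h.2] at key
  have s1 : μ.real (D \ PC) = μ.real D - μ.real (D ∩ PC) := by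
    have := measureReal_inter_add_sdiff (μ := μ) (s := D) (MeasurableSet.of_discrete (s := PC)); linarith
  have s2 : μ.real ((D \ PC) ∩ At) = μ.real (D ∩ At) - μ.real (D ∩ (At ∩ PC)) := by
    have := measureReal_inter_add_sdiff (μ := μ) (s := D ∩ At) (MeasurableSet.of_discrete (s := PC))
    have e : (D ∩ At) \ PC = (D \ PC) ∩ At := by ext ω; simp only [mem_sdiff, mem_inter_iff]; tauto
    have e' : D ∩ At ∩ PC = D ∩ (At ∩ PC) := by rw [inter_assoc]
    rw [e, e'] at this; linarith
  rw [s1, s2]; nlinarith [key]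

/-- **Kozma–Nitzan Lemma 2 for two blocks (PROVED): `φ_{B₁} + φ_{B₂} ≤ φ_{B₁ ∪ B₂}`** for disjoint `B₁, B₂ ⊆ S`, provided the points of
`S` are simultaneously separable with positive probability.  [cite: KozmaNitzan2024, Lemma 2 (p. 6); VandenbergHaggstromKahn2005, Thms. 1.3, 1.4] -/
theorem phi_superadd (w : Sym2 (Fin n) → unitInterval) (o : Fin n) (S B₁ B₂ : Finset (Fin n)) (hdisj : Disjoint B₁ B₂)
    (hBS : B₁ ∪ B₂ ⊆ S)
    (hM : 0 < (prodBernoulli w).real {ω : BondConfig (Fin n) | ∀ k ∈ S, ∀ l ∈ S, k ≠ l → ¬ (openGraph ω).Reachable k l}) :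
    (prodBernoulli w).real ({ω : BondConfig (Fin n) | ∀ s ∈ B₁, ∀ t ∈ S \ B₁, ¬ (openGraph ω).Reachable s t} ∩
          ⋃ s ∈ B₁, (openConn s o : Set (BondConfig (Fin n)))) /
        (prodBernoulli w).real {ω : BondConfig (Fin n) | ∀ s ∈ B₁, ∀ t ∈ S \ B₁, ¬ (openGraph ω).Reachable s t} +
      (prodBernoulli w).real ({ω : BondConfig (Fin n) | ∀ s ∈ B₂, ∀ t ∈ S \ B₂, ¬ (openGraph ω).Reachable s t} ∩
          ⋃ s ∈ B₂, (openConn s o : Set (BondConfig (Fin n)))) /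
        (prodBernoulli w).real {ω : BondConfig (Fin n) | ∀ s ∈ B₂, ∀ t ∈ S \ B₂, ¬ (openGraph ω).Reachable s t} ≤
      (prodBernoulli w).real ({ω : BondConfig (Fin n) | ∀ s ∈ B₁ ∪ B₂, ∀ t ∈ S \ (B₁ ∪ B₂), ¬ (openGraph ω).Reachable s t} ∩
          ⋃ s ∈ B₁ ∪ B₂, (openConn s o : Set (BondConfig (Fin n)))) /
        (prodBernoulli w).real {ω : BondConfig (Fin n) | ∀ s ∈ B₁ ∪ B₂, ∀ t ∈ S \ (B₁ ∪ B₂), ¬ (openGraph ω).Reachable s t} := by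
  set μ := prodBernoulli w with hμ
  set B := B₁ ∪ B₂ with hB
  set R := S \ B with hR
  have hB₁S : B₁ ⊆ S := fun x hx => hBS (Finset.mem_union_left _ hx)
  have hB₂S : B₂ ⊆ S := fun x hx => hBS (Finset.mem_union_right _ hx)
  have hB₂E : B₂ ⊆ S \ B₁ := fun x hx => Finset.mem_sdiff.2 ⟨hB₂S hx, fun h => Finset.disjoint_left.1 hdisj h hx⟩
  have hB₁E : B₁ ⊆ S \ B₂ := fun x hx => Finset.mem_sdiff.2 ⟨hB₁S hx, fun h => Finset.disjoint_left.1 hdisj hx h⟩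
  set D₁ : Set (BondConfig (Fin n)) := {ω | ∀ s ∈ B₁, ∀ t ∈ S \ B₁, ¬ (openGraph ω).Reachable s t} with hD₁
  set D₂ : Set (BondConfig (Fin n)) := {ω | ∀ s ∈ B₂, ∀ t ∈ S \ B₂, ¬ (openGraph ω).Reachable s t} with hD₂
  set D : Set (BondConfig (Fin n)) := {ω | ∀ s ∈ B, ∀ t ∈ S \ B, ¬ (openGraph ω).Reachable s t} with hD
  set At₁ : Set (BondConfig (Fin n)) := ⋃ s ∈ B₁, (openConn s o : Set (BondConfig (Fin n))) with hAt₁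
  set At₂ : Set (BondConfig (Fin n)) := ⋃ s ∈ B₂, (openConn s o : Set (BondConfig (Fin n))) with hAt₂
  set At : Set (BondConfig (Fin n)) := ⋃ s ∈ B, (openConn s o : Set (BondConfig (Fin n))) with hAt
  set PC₁ : Set (BondConfig (Fin n)) := {ω | ∃ k ∈ B₂, ∃ j ∈ R, k ≠ j ∧ (openGraph ω).Reachable k j} with hPC₁
  set PC₂ : Set (BondConfig (Fin n)) := {ω | ∃ k ∈ B₁, ∃ j ∈ R, k ≠ j ∧ (openGraph ω).Reachable k j} with hPC₂
  set PC : Set (BondConfig (Fin n)) := {ω | ∃ k ∈ B₁, ∃ j ∈ B₂, k ≠ j ∧ (openGraph ω).Reachable k j} with hPC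
  -- the common refinement M'
  set M' : Set (BondConfig (Fin n)) := {ω | (∀ s ∈ B₁, ∀ t ∈ B₂, ¬ (openGraph ω).Reachable s t) ∧
      (∀ s ∈ B₁, ∀ t ∈ R, ¬ (openGraph ω).Reachable s t) ∧ (∀ s ∈ B₂, ∀ t ∈ R, ¬ (openGraph ω).Reachable s t)} with hM'
  have memR : ∀ t, t ∈ R ↔ t ∈ S ∧ t ∉ B₁ ∧ t ∉ B₂ := fun t => by
    rw [hR, Finset.mem_sdiff, hB, Finset.mem_union, not_or]
  have e1 : D₁ \ PC₁ = M' := by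
    ext ω
    simp only [mem_sdiff, hD₁, hPC₁, hM', mem_setOf_eq, not_exists, not_and]
    constructor
    · rintro ⟨hd, hpc⟩
      refine ⟨fun s hs t ht => hd s hs t (hB₂E ht), fun s hs t ht => hd s hs t (Finset.mem_sdiff.2 ⟨((memR t).1 ht).1, ((memR t).1 ht).2.1⟩),
        fun s hs t ht h => hpc s hs t ht (fun hst => ((memR t).1 ht).2.2 (hst ▸ hs)) h⟩
    · rintro ⟨h12, h1R, h2R⟩
      refine ⟨fun s hs t ht => ?_, fun k hk j hj _ h => h2R k hk j hj h⟩
      by_cases ht2 : t ∈ B₂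
      · exact h12 s hs t ht2
      · exact h1R s hs t ((memR t).2 ⟨(Finset.mem_sdiff.1 ht).1, (Finset.mem_sdiff.1 ht).2, ht2⟩)
  have e2 : D₂ \ PC₂ = M' := by
    ext ω
    simp only [mem_sdiff, hD₂, hPC₂, hM', mem_setOf_eq, not_exists, not_and]
    constructor
    · rintro ⟨hd, hpc⟩
      refine ⟨fun s hs t ht h => hd t ht s (hB₁E hs) h.symm, fun s hs t ht h => hpc s hs t ht (fun hst => ((memR t).1 ht).2.1 (hst ▸ hs)) h,
        fun s hs t ht => hd s hs t (Finset.mem_sdiff.2 ⟨((memR t).1 ht).1, ((memR t).1 ht).2.2⟩)⟩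
    · rintro ⟨h12, h1R, h2R⟩
      refine ⟨fun s hs t ht => ?_, fun k hk j hj _ h => h1R k hk j hj h⟩
      by_cases ht1 : t ∈ B₁
      · exact fun h => h12 t ht1 s hs h.symm
      · exact h2R s hs t ((memR t).2 ⟨(Finset.mem_sdiff.1 ht).1, ht1, (Finset.mem_sdiff.1 ht).2⟩)
  have e3 : D \ PC = M' := by
    ext ω
    simp only [mem_sdiff, hD, hPC, hM', mem_setOf_eq, not_exists, not_and, hB, Finset.mem_union]
    constructor
    · rintro ⟨hd, hpc⟩
      refine ⟨fun s hs t ht h => hpc s hs t ht (fun hst => Finset.disjoint_left.1 hdisj hs (hst ▸ ht)) h,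
        fun s hs t ht => hd s (Or.inl hs) t (by rw [hR, hB] at ht; exact ht), fun s hs t ht => hd s (Or.inr hs) t (by rw [hR, hB] at ht; exact ht)⟩
    · rintro ⟨h12, h1R, h2R⟩
      refine ⟨fun s hs t ht => ?_, fun k hk j hj _ h => h12 k hk j hj h⟩
      have htR : t ∈ R := by rw [hR, hB]; exact ht
      rcases hs with hs | hs
      · exact h1R s hs t htR
      · exact h2R s hs t htR
  -- the three BHK steps
  have iA1 := phi_stepA w o S B₁ B₂ R hB₂E
  have iA2 := phi_stepA w o S B₂ B₁ R hB₁E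
  have iC := phi_stepC w o S B B₁ B₂ Finset.subset_union_left
  rw [← hD₁, ← hAt₁, ← hPC₁, e1] at iA1
  rw [← hD₂, ← hAt₂, ← hPC₂, e2] at iA2
  rw [← hD, ← hAt, ← hPC, e3] at iC
  -- iA1 : μ(D₁ ∩ At₁) · μ(M') ≤ μ(D₁) · μ(M' ∩ At₁) ; iA2 sym. ; iC : μ(M' ∩ At) · μ(D) ≤ μ(M') · μ(D ∩ At)
  -- disjoint union on M'
  have eU : μ.real (M' ∩ At₁) + μ.real (M' ∩ At₂) = μ.real (M' ∩ At) := by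
    rw [← measureReal_union _ MeasurableSet.of_discrete]
    · congr 1
      ext ω
      simp only [mem_union, mem_inter_iff, hAt₁, hAt₂, hAt, hB, mem_iUnion, exists_prop, Finset.mem_union]
      constructor
      · rintro (⟨hm, s, hs, hso⟩ | ⟨hm, s, hs, hso⟩)
        · exact ⟨hm, s, Or.inl hs, hso⟩
        · exact ⟨hm, s, Or.inr hs, hso⟩
      · rintro ⟨hm, s, (hs | hs), hso⟩
        · exact Or.inl ⟨hm, s, hs, hso⟩
        · exact Or.inr ⟨hm, s, hs, hso⟩
    · rw [Set.disjoint_left]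
      rintro ω ⟨hm, h1⟩ ⟨_, h2⟩
      simp only [hAt₁, hAt₂, mem_iUnion, exists_prop] at h1 h2
      obtain ⟨s, hs, hso⟩ := h1
      obtain ⟨t, ht, hto⟩ := h2
      have hso' : (openGraph ω).Reachable s o := hso
      have hto' : (openGraph ω).Reachable t o := hto
      exact hm.1 s hs t ht (hso'.trans hto'.symm)
  -- positivity
  have hpos : ∀ (X : Finset (Fin n)), X ⊆ S → 0 < μ.real {ω : BondConfig (Fin n) | ∀ s ∈ X, ∀ t ∈ S \ X, ¬ (openGraph ω).Reachable s t} := by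
    intro X hXS
    refine lt_of_lt_of_le hM (measureReal_mono ?_ (measure_ne_top _ _))
    intro ω hω s hs t ht
    exact hω s (hXS hs) t (Finset.mem_sdiff.1 ht).1 (fun h => (Finset.mem_sdiff.1 ht).2 (h ▸ hs))
  have hM'pos : 0 < μ.real M' := by
    refine lt_of_lt_of_le hM (measureReal_mono ?_ (measure_ne_top _ _))
    intro ω hω
    refine ⟨fun s hs t ht => hω s (hB₁S hs) t (hB₂S ht) (fun h => Finset.disjoint_left.1 hdisj hs (h ▸ ht)),
      fun s hs t ht => hω s (hB₁S hs) t ((memR t).1 ht).1 (fun h => ((memR t).1 ht).2.1 (h ▸ hs)),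
      fun s hs t ht => hω s (hB₂S hs) t ((memR t).1 ht).1 (fun h => ((memR t).1 ht).2.2 (h ▸ hs))⟩
  have hd1 := hpos B₁ hB₁S
  have hd2 := hpos B₂ hB₂S
  have hd := hpos B hBS
  change 0 < μ.real D₁ at hd1
  change 0 < μ.real D₂ at hd2
  change 0 < μ.real D at hd
  show μ.real (D₁ ∩ At₁) / μ.real D₁ + μ.real (D₂ ∩ At₂) / μ.real D₂ ≤ μ.real (D ∩ At) / μ.real D
  have j1 : μ.real (D₁ ∩ At₁) / μ.real D₁ ≤ μ.real (M' ∩ At₁) / μ.real M' := by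
    rw [div_le_div_iff₀ hd1 hM'pos]; linarith
  have j2 : μ.real (D₂ ∩ At₂) / μ.real D₂ ≤ μ.real (M' ∩ At₂) / μ.real M' := by
    rw [div_le_div_iff₀ hd2 hM'pos]; linarith
  have j3 : μ.real (M' ∩ At) / μ.real M' ≤ μ.real (D ∩ At) / μ.real D := by
    rw [div_le_div_iff₀ hM'pos hd]; linarith
  calc μ.real (D₁ ∩ At₁) / μ.real D₁ + μ.real (D₂ ∩ At₂) / μ.real D₂
      ≤ μ.real (M' ∩ At₁) / μ.real M' + μ.real (M' ∩ At₂) / μ.real M' := add_le_add j1 j2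
    _ = μ.real (M' ∩ At) / μ.real M' := by rw [← add_div, eU]
    _ ≤ μ.real (D ∩ At) / μ.real D := j3

end GiantKn

end Summit.CriticalPhenomena.PercolationContinuityZ3.Theorems

end
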